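import Summits.AtomisticToContinuum.Crystallization.Theorems.PhononSlackCertificatesPeriodicGivenLayeredRegistry2
import Literature.MathematicalPhysics.StatisticalMechanics.BarlowStackingEnergy
import Literature.Algebra.EuclideanLattices.FccBccLattices

/-!
# Crux `HcpLandscapeGap` (stmt-AtomisticToContinuum-12087), line `registered` (birth) — stub RS
# `stub_slipLayerBernstein`

STUB RS of the far-layer lateral bound of the slip cut (`Cruxes/HcpLandscapeGap/Lines/birth.lean`,
lead c7): the REAL-SPACE facts about the general-offset Lennard-Jones layer sum

  `Ψ(a, t, ξ) = Σ'_{(i,j) ∈ ℤ²} V_LJ ‖i u + j v + ξ + t e₃‖`,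

`u = triangularVec₁ a`, `v = triangularVec₂ a`, `w = barlowOffset a = (u + v)/3`, `t e₃ = layerNormal t`,
for `a > 0`, `t ≠ 0`:

* (i) lattice-translation invariance `Ψ(a,t, σ w + p u + q v + ε) = Ψ(a,t, σ w + ε)` (reindex `ℤ²` by
  `(i, j) ↦ (i − p, j − q)`, `Equiv.tsum_eq`);
* (ii) invariance under the in-plane rotation `R` by `120°` of an in-plane `ε`:
  `Ψ(a,t, σ w + R ε) = Ψ(a,t, σ w + ε)`; since `R u = v − u`, `R v = −u`, `R w = w − u`, one has
  `R (i u + j v + σ w + ε) = (−i − j − σ) u + i v + σ w + R ε`, so this is the reindexing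
  `(i, j) ↦ (−i − j − σ, i)` of `ℤ²` plus the pointwise equality of norms (checked in coordinates);
* (iii) the Bernstein representation, for every in-plane `ξ`:
  `Ψ(a,t,ξ) = ∫_0^∞ Θ(a,c,ξ) · w(c) · e^{−c t²} dc`, `Θ(a,c,ξ) = Σ' e^{−c ‖i u + j v + ξ‖²}`,
  `w(c) = lennardJonesDensity c = c⁵/1440 − c²/12`, together with the summability of the layer sum, of
  the shifted Gaussian layer sums, and the integrability of the integrand on `(0, ∞)`.

Part (iii) is the verbatim analogue of `LayeredHull.reg_layerInteraction_eq_integral`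
(`PhononSlackCertificatesPeriodicGivenLayeredRegistry1/2.lean`, the case `ξ = δ w`) with the letter
offset replaced by a general in-plane shift: `‖x + t e₃‖² = ‖x‖² + t²` for in-plane `x`,
`V_LJ(√s) = s⁻⁶/12 − s⁻³/6`, Euler's integral `n!/qⁿ⁺¹ = ∫_0^∞ cⁿ e^{−cq} dc` termwise and
`hasSum_integral_of_summable_integral_norm`; the summability of `Σ ((‖i u + j v + ξ‖² + T)ᵖ)⁻¹` is reduced
to `LayeredHull.reg_summable_inv_pow` through `a²(i² + j²)/16 ≤ ‖i u + j v + ξ‖² + ‖ξ‖²`, the shifted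
Gaussian sums are summable and dominated by the unshifted one (`LayeredHull.reg_gauss_layer`, Banaszczyk),
which is `≤ (1 + 4/(a²c))²` (`LayeredHull.reg_theta_zero_le`).  All [folklore].
-/

noncomputable section

namespace Summit.AtomisticToContinuum.Crystallization.Theorems.HcpLandscapeGapBirth

open MeasureTheory Set Real Filter
open scoped BigOperators Nat
open Literature.MathematicalPhysics.StatisticalMechanics Literature.Algebra.EuclideanLattices
open Summit.AtomisticToContinuum.Crystallization.Theorems

namespace SlipLayerBernstein

/-! ### Coordinates and norms -/

/-- Coordinates of the in-plane shifted lattice point `i u + j v + ξ`. [folklore] -/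
theorem slipVec_apply (a : ℝ) (i j : ℤ) (ξ : EuclideanSpace ℝ (Fin 3)) :
    ((i : ℝ) • triangularVec₁ a + (j : ℝ) • triangularVec₂ a + ξ) 0 = a * (i + j / 2) + ξ 0 ∧
    ((i : ℝ) • triangularVec₁ a + (j : ℝ) • triangularVec₂ a + ξ) 1 = a * √3 / 2 * j + ξ 1 ∧
    ((i : ℝ) • triangularVec₁ a + (j : ℝ) • triangularVec₂ a + ξ) 2 = ξ 2 := by
  refine ⟨?_, ?_, ?_⟩ <;> simp [triangularVec₁, triangularVec₂] <;> ring

/-- Pythagoras: `‖x + t e₃‖² = ‖x‖² + t²` for in-plane `x` (`norm_sq_fin_three`). [folklore] -/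
theorem norm_add_layerNormal_sq (x : EuclideanSpace ℝ (Fin 3)) (hx : x 2 = 0) (t : ℝ) :
    ‖x + layerNormal t‖ ^ 2 = ‖x‖ ^ 2 + t ^ 2 := by
  rw [norm_sq_fin_three, norm_sq_fin_three]
  simp [layerNormal, hx]

/-- `V_LJ ‖x + t e₃‖ = (‖x‖² + t²)⁻⁶/12 − (‖x‖² + t²)⁻³/6` for in-plane `x`. [folklore] -/
theorem lennardJones_slip (x : EuclideanSpace ℝ (Fin 3)) (hx : x 2 = 0) (t : ℝ) :
    lennardJones ‖x + layerNormal t‖ =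
      (1 / 12) * ((‖x‖ ^ 2 + t ^ 2) ^ 6)⁻¹ - (1 / 6) * ((‖x‖ ^ 2 + t ^ 2) ^ 3)⁻¹ := by
  unfold lennardJones
  rw [← norm_add_layerNormal_sq x hx t, inv_pow, inv_pow, ← pow_mul, ← pow_mul]

/-! ### (i) Lattice translations -/

/-- **Lattice-translation invariance** of a general-offset layer sum: shifting the offset by
`p u + q v` is the reindexing `(i, j) ↦ (i − p, j − q)` of `ℤ²`. [folklore] -/
theorem tsum_translate (V : ℝ → ℝ) (a t : ℝ) (σ p q : ℤ) (ε : EuclideanSpace ℝ (Fin 3)) :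
    ∑' ij : ℤ × ℤ, V ‖(ij.1 : ℝ) • triangularVec₁ a + (ij.2 : ℝ) • triangularVec₂ a +
        (((σ : ℝ) • barlowOffset a + (p : ℝ) • triangularVec₁ a + (q : ℝ) • triangularVec₂ a) + ε) +
        layerNormal t‖ =
      ∑' ij : ℤ × ℤ, V ‖(ij.1 : ℝ) • triangularVec₁ a + (ij.2 : ℝ) • triangularVec₂ a +
        ((σ : ℝ) • barlowOffset a + ε) + layerNormal t‖ := by
  rw [← Equiv.tsum_eq ((Equiv.subRight p).prodCongr (Equiv.subRight q))]
  refine tsum_congr fun ij => ?_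
  simp only [Equiv.prodCongr_apply, Prod.map_fst, Prod.map_snd, Equiv.subRight_apply, Int.cast_sub]
  congr 2
  module

/-! ### (ii) The rotation by `120°` -/

/-- **The pointwise identity behind the rotation invariance**: with `R` the in-plane rotation by
`120°` (`R u = v − u`, `R v = −u`, `R w = w − u`), for in-plane `ε`,
`‖(−i − j − σ) u + i v + σ w + R ε + t e₃‖ = ‖i u + j v + σ w + ε + t e₃‖` (the left vector is
`R` of the in-plane part of the right one, plus `t e₃`; checked in coordinates, `√3² = 3`). [folklore] -/
theorem norm_rot (a t : ℝ) (σ i j : ℤ) (ε : EuclideanSpace ℝ (Fin 3)) (hε : ε 2 = 0) :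
    ‖((-i - j - σ : ℤ) : ℝ) • triangularVec₁ a + (i : ℝ) • triangularVec₂ a + ((σ : ℝ) • barlowOffset a +
        (!₂[-(ε 0) / 2 - Real.sqrt 3 / 2 * ε 1, Real.sqrt 3 / 2 * ε 0 - ε 1 / 2, 0] :
          EuclideanSpace ℝ (Fin 3))) + layerNormal t‖ =
      ‖(i : ℝ) • triangularVec₁ a + (j : ℝ) • triangularVec₂ a + ((σ : ℝ) • barlowOffset a + ε) +
        layerNormal t‖ := by
  have h3 : Real.sqrt 3 ^ 2 = 3 := Real.sq_sqrt (by norm_num)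
  refine (sq_eq_sq₀ (norm_nonneg _) (norm_nonneg _)).1 ?_
  rw [norm_sq_fin_three, norm_sq_fin_three]
  simp [triangularVec₁, triangularVec₂, barlowOffset, layerNormal, hε]
  linear_combination (ε 1 ^ 2 / 4 + (a * i / 2 + σ * a / 6 + ε 0 / 2) ^ 2 - (a * j / 2 + σ * a / 6) ^ 2) * h3

/-- **Rotation invariance** of the general-offset layer sum for in-plane `ε`:
`Σ' V ‖i u + j v + σ w + R ε + t e₃‖ = Σ' V ‖i u + j v + σ w + ε + t e₃‖` (reindex `ℤ²` by the bijection
`(i, j) ↦ (−i − j − σ, i)`, of inverse `(i, j) ↦ (j, −i − j − σ)`, and use `norm_rot`). [folklore] -/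
theorem tsum_rotate (V : ℝ → ℝ) (a t : ℝ) (σ : ℤ) (ε : EuclideanSpace ℝ (Fin 3)) (hε : ε 2 = 0) :
    ∑' ij : ℤ × ℤ, V ‖(ij.1 : ℝ) • triangularVec₁ a + (ij.2 : ℝ) • triangularVec₂ a +
        ((σ : ℝ) • barlowOffset a +
          (!₂[-(ε 0) / 2 - Real.sqrt 3 / 2 * ε 1, Real.sqrt 3 / 2 * ε 0 - ε 1 / 2, 0] :
            EuclideanSpace ℝ (Fin 3))) + layerNormal t‖ =
      ∑' ij : ℤ × ℤ, V ‖(ij.1 : ℝ) • triangularVec₁ a + (ij.2 : ℝ) • triangularVec₂ a +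
        ((σ : ℝ) • barlowOffset a + ε) + layerNormal t‖ := by
  rw [← Equiv.tsum_eq (⟨fun ij => (-ij.1 - ij.2 - σ, ij.1), fun ij => (ij.2, -ij.1 - ij.2 - σ),
    fun ij => Prod.ext rfl (by dsimp only; ring), fun ij => Prod.ext (by dsimp only; ring) rfl⟩ : ℤ × ℤ ≃ ℤ × ℤ)]
  refine tsum_congr fun ij => ?_
  simp only [Equiv.coe_fn_mk]
  exact congrArg V (norm_rot a t σ ij.1 ij.2 ε hε)

/-! ### (iii) Summability and the Gaussian layer sums with a general in-plane shift -/

/-- Coercivity of the shifted in-plane lattice: `a² (i² + j²)/16 ≤ ‖i u + j v + ξ‖² + ‖ξ‖²`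
(`‖i u + j v‖² ≥ a²(i² + j²)/8` and the triangle inequality). [folklore] -/
theorem sq_le_norm_slipVec_sq (a : ℝ) (i j : ℤ) (ξ : EuclideanSpace ℝ (Fin 3)) :
    a ^ 2 / 16 * ((i : ℝ) ^ 2 + j ^ 2) ≤
      ‖(i : ℝ) • triangularVec₁ a + (j : ℝ) • triangularVec₂ a + ξ‖ ^ 2 + ‖ξ‖ ^ 2 := by
  have h1 : ((i : ℝ) ^ 2 + j ^ 2) / 8 ≤ ‖layerVec 1 0 0 0 i j‖ ^ 2 :=
    LayeredHull.reg_sq_le_norm_layerVec_one_sq 0 (Or.inl rfl) i j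
  have h2 : ‖layerVec a 0 0 0 i j‖ ^ 2 = a ^ 2 * ‖layerVec 1 0 0 0 i j‖ ^ 2 :=
    LayeredHull.reg_norm_layerVec_scale_sq a 0 i j
  rw [layerVec_zero_zero] at h2
  have h4 : ‖(i : ℝ) • triangularVec₁ a + (j : ℝ) • triangularVec₂ a‖ ≤
      ‖(i : ℝ) • triangularVec₁ a + (j : ℝ) • triangularVec₂ a + ξ‖ + ‖ξ‖ := norm_le_add_norm_add _ _
  have h5 : ‖(i : ℝ) • triangularVec₁ a + (j : ℝ) • triangularVec₂ a‖ ^ 2 ≤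
      (‖(i : ℝ) • triangularVec₁ a + (j : ℝ) • triangularVec₂ a + ξ‖ + ‖ξ‖) ^ 2 :=
    pow_le_pow_left₀ (norm_nonneg _) h4 2
  have h6 := mul_le_mul_of_nonneg_left h1 (sq_nonneg a)
  nlinarith [h5, h6, h2, sq_nonneg (‖(i : ℝ) • triangularVec₁ a + (j : ℝ) • triangularVec₂ a + ξ‖ - ‖ξ‖)]

/-- Summability of the inverse powers `Σ ((‖i u + j v + ξ‖² + T)ᵖ)⁻¹`, `p ≥ 2`, `T > 0`, `a > 0`
(comparison with `LayeredHull.reg_summable_inv_pow` for the coercive `a²(i² + j²)/16`, through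
`a²(i² + j²)/16 + T ≤ ((‖ξ‖² + T)/T) · (‖i u + j v + ξ‖² + T)`). [folklore] -/
theorem summable_inv_pow_slip {a : ℝ} (ha : 0 < a) (ξ : EuclideanSpace ℝ (Fin 3)) {T : ℝ} (hT : 0 < T)
    (p : ℕ) (hp : 2 ≤ p) :
    Summable fun ij : ℤ × ℤ =>
      ((‖(ij.1 : ℝ) • triangularVec₁ a + (ij.2 : ℝ) • triangularVec₂ a + ξ‖ ^ 2 + T) ^ p)⁻¹ := by
  set K : ℝ := (‖ξ‖ ^ 2 + T) / T with hK
  have hK0 : 0 < K := by positivity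
  have hs := LayeredHull.reg_summable_inv_pow (fun ij : ℤ × ℤ => a ^ 2 / 16 * ((ij.1 : ℝ) ^ 2 + ij.2 ^ 2))
    (a ^ 2 / 16) T (by positivity) hT (fun ij => le_rfl) p hp
  refine (hs.mul_left (K ^ p)).of_nonneg_of_le (fun ij => by positivity) (fun ij => ?_)
  have hq := sq_le_norm_slipVec_sq a ij.1 ij.2 ξ
  set P := ‖(ij.1 : ℝ) • triangularVec₁ a + (ij.2 : ℝ) • triangularVec₂ a + ξ‖ ^ 2 with hP
  have hP0 : 0 ≤ P := by positivity
  have h0 : 0 < a ^ 2 / 16 * ((ij.1 : ℝ) ^ 2 + ij.2 ^ 2) + T := by positivity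
  have h1 : a ^ 2 / 16 * ((ij.1 : ℝ) ^ 2 + ij.2 ^ 2) + T ≤ K * (P + T) := by
    have hK' : K * (P + T) = (‖ξ‖ ^ 2 + T) * (P + T) / T := by
      rw [hK]
      ring
    rw [hK', le_div_iff₀ hT]
    nlinarith [mul_nonneg (sq_nonneg ‖ξ‖) hP0]
  calc ((P + T) ^ p)⁻¹ = K ^ p * ((K * (P + T)) ^ p)⁻¹ := by
        rw [mul_pow, mul_inv, ← mul_assoc, mul_inv_cancel₀ (pow_ne_zero _ hK0.ne'), one_mul]
    _ ≤ K ^ p * ((a ^ 2 / 16 * ((ij.1 : ℝ) ^ 2 + ij.2 ^ 2) + T) ^ p)⁻¹ :=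
        mul_le_mul_of_nonneg_left (inv_anti₀ (pow_pos h0 p) (pow_le_pow_left₀ h0.le h1 p))
          (by positivity)

/-- Summability of the shifted Gaussian layer sum `Σ e^{−c ‖i u + j v + ξ‖²}` for `c > 0`, `a ≠ 0`
(`LayeredHull.reg_gauss_layer` with the shift `−ξ`). [folklore] -/
theorem summable_gauss_slip {a : ℝ} (ha : a ≠ 0) {c : ℝ} (hc : 0 < c) (ξ : EuclideanSpace ℝ (Fin 3)) :
    Summable fun ij : ℤ × ℤ =>
      Real.exp (-c * ‖(ij.1 : ℝ) • triangularVec₁ a + (ij.2 : ℝ) • triangularVec₂ a + ξ‖ ^ 2) := by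
  have h := (LayeredHull.reg_gauss_layer ha hc (-ξ)).1
  simpa only [sub_neg_eq_add] using h

/-- **The shifted Gaussian layer sum is at most `(1 + 4/(a²c))²`**: it is dominated by the unshifted
one (Banaszczyk, `LayeredHull.reg_gauss_layer`), which is `θ^a_0(c) ≤ (1 + 4/(a²c))²`
(`LayeredHull.reg_theta_zero_le`). [folklore] -/
theorem theta_slip_le {a : ℝ} (ha : a ≠ 0) {c : ℝ} (hc : 0 < c) (ξ : EuclideanSpace ℝ (Fin 3)) :
    ∑' ij : ℤ × ℤ, Real.exp (-c * ‖(ij.1 : ℝ) • triangularVec₁ a + (ij.2 : ℝ) • triangularVec₂ a + ξ‖ ^ 2) ≤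
      (1 + 4 / (a ^ 2 * c)) ^ 2 := by
  have h := (LayeredHull.reg_gauss_layer ha hc (-ξ)).2
  simp only [sub_neg_eq_add] at h
  refine h.trans ?_
  have h2 := LayeredHull.reg_theta_zero_le ha hc
  rw [LayeredHull.reg_theta_def] at h2
  simpa only [layerVec_zero_zero] using h2

/-- The shifted Gaussian layer sum is non-increasing in `c` on `(0, ∞)`. [folklore] -/
theorem theta_slip_antitoneOn {a : ℝ} (ha : a ≠ 0) (ξ : EuclideanSpace ℝ (Fin 3)) :
    AntitoneOn (fun c : ℝ => ∑' ij : ℤ × ℤ,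
      Real.exp (-c * ‖(ij.1 : ℝ) • triangularVec₁ a + (ij.2 : ℝ) • triangularVec₂ a + ξ‖ ^ 2)) (Ioi 0) := by
  intro c₁ hc₁ c₂ hc₂ h12
  exact Summable.tsum_le_tsum (fun ij => Real.exp_le_exp.2
      (by nlinarith [sq_nonneg ‖(ij.1 : ℝ) • triangularVec₁ a + (ij.2 : ℝ) • triangularVec₂ a + ξ‖]))
    (summable_gauss_slip ha hc₂ ξ) (summable_gauss_slip ha hc₁ ξ)

/-! ### (iii) Fubini: inverse-power layer sums as transforms of the shifted Gaussian layer sum -/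

/-- **Inverse-power shifted layer sums are Laplace transforms of the shifted Gaussian layer sum**:
for `a > 0`, `T > 0`, `n ≥ 1`,
`Σ_{(i,j)} n! / (‖i u + j v + ξ‖² + T)ⁿ⁺¹ = ∫_0^∞ cⁿ e^{−cT} Θ(a,c,ξ) dc`
(Euler's integral termwise and `hasSum_integral_of_summable_integral_norm`; the pattern of
`LayeredHull.reg_hasSum_inv_pow_integral`). [folklore] -/
theorem hasSum_inv_pow_integral_slip {a : ℝ} (ha : 0 < a) (ξ : EuclideanSpace ℝ (Fin 3)) {T : ℝ}
    (hT : 0 < T) (n : ℕ) (hn : 1 ≤ n) :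
    HasSum (fun ij : ℤ × ℤ =>
        (n ! : ℝ) / (‖(ij.1 : ℝ) • triangularVec₁ a + (ij.2 : ℝ) • triangularVec₂ a + ξ‖ ^ 2 + T) ^ (n + 1))
      (∫ c in Ioi (0 : ℝ), c ^ n * Real.exp (-(c * T)) *
        ∑' ij : ℤ × ℤ, Real.exp (-c * ‖(ij.1 : ℝ) • triangularVec₁ a + (ij.2 : ℝ) • triangularVec₂ a + ξ‖ ^ 2)) := by
  set q : ℤ × ℤ → ℝ := fun ij =>
    ‖(ij.1 : ℝ) • triangularVec₁ a + (ij.2 : ℝ) • triangularVec₂ a + ξ‖ ^ 2 + T with hq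
  have hq0 : ∀ ij, 0 < q ij := fun ij => by positivity
  set F : ℤ × ℤ → ℝ → ℝ := fun ij c => Real.exp (-(c * q ij)) * c ^ n with hF
  have hint : ∀ ij, Integrable (F ij) (volume.restrict (Ioi 0)) := fun ij =>
    integrableOn_exp_neg_mul_mul_pow n (hq0 ij)
  have hnorm : ∀ ij, ∫ c in Ioi (0 : ℝ), ‖F ij c‖ = n ! / (q ij) ^ (n + 1) := fun ij => by
    rw [← integral_exp_neg_mul_mul_pow n (hq0 ij)]
    refine setIntegral_congr_fun measurableSet_Ioi fun c hc => ?_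
    have hc' : 0 < c := hc
    exact Real.norm_of_nonneg (by positivity)
  have hsum : Summable fun ij => ∫ c in Ioi (0 : ℝ), ‖F ij c‖ := by
    simp_rw [hnorm]
    have h := summable_inv_pow_slip ha ξ hT (n + 1) (by omega)
    simpa [div_eq_mul_inv] using h.mul_left (n ! : ℝ)
  have key := hasSum_integral_of_summable_integral_norm hint hsum
  have hfun : (fun ij => ∫ c in Ioi (0 : ℝ), F ij c) = fun ij : ℤ × ℤ =>
      (n ! : ℝ) / (‖(ij.1 : ℝ) • triangularVec₁ a + (ij.2 : ℝ) • triangularVec₂ a + ξ‖ ^ 2 + T) ^ (n + 1) :=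
    funext fun ij => integral_exp_neg_mul_mul_pow n (hq0 ij)
  have hval : (∫ c in Ioi (0 : ℝ), ∑' ij : ℤ × ℤ, F ij c) =
      ∫ c in Ioi (0 : ℝ), c ^ n * Real.exp (-(c * T)) *
        ∑' ij : ℤ × ℤ, Real.exp (-c * ‖(ij.1 : ℝ) • triangularVec₁ a + (ij.2 : ℝ) • triangularVec₂ a + ξ‖ ^ 2) := by
    refine setIntegral_congr_fun measurableSet_Ioi fun c _ => ?_
    have he : ∀ ij : ℤ × ℤ, F ij c =
        Real.exp (-c * ‖(ij.1 : ℝ) • triangularVec₁ a + (ij.2 : ℝ) • triangularVec₂ a + ξ‖ ^ 2) *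
          (Real.exp (-(c * T)) * c ^ n) := fun ij => by
      simp only [hF, hq, mul_add, neg_add, Real.exp_add, neg_mul]
      ring
    rw [tsum_congr he, tsum_mul_right]
    ring
  rw [hfun, hval] at key
  exact key

/-- **Integrability**: `c ↦ cⁿ e^{−cs} Θ(a,c,ξ)` is integrable on `(0, ∞)` for `n ≥ 2`, `s > 0`, `a ≠ 0`
(dominated by `(c + 4/a²)² cⁿ⁻² e^{−cs}`; measurable because `Θ` is monotone in `c`; the pattern of
`LayeredHull.reg_integrableOn_theta_mul`). [folklore] -/
theorem integrableOn_theta_slip_mul {a : ℝ} (ha : a ≠ 0) (ξ : EuclideanSpace ℝ (Fin 3)) {s : ℝ}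
    (hs : 0 < s) (n : ℕ) (hn : 2 ≤ n) :
    IntegrableOn (fun c => c ^ n * Real.exp (-(c * s)) *
      ∑' ij : ℤ × ℤ, Real.exp (-c * ‖(ij.1 : ℝ) • triangularVec₁ a + (ij.2 : ℝ) • triangularVec₂ a + ξ‖ ^ 2))
      (Ioi 0) := by
  obtain ⟨m, rfl⟩ : ∃ m, n = m + 2 := ⟨n - 2, by omega⟩
  have ha2 : 0 < a ^ 2 := by positivity
  have hmeas : AEStronglyMeasurable (fun c => c ^ (m + 2) * Real.exp (-(c * s)) *
      ∑' ij : ℤ × ℤ, Real.exp (-c * ‖(ij.1 : ℝ) • triangularVec₁ a + (ij.2 : ℝ) • triangularVec₂ a + ξ‖ ^ 2))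
      (volume.restrict (Ioi 0)) := by
    refine ((by fun_prop : Continuous fun c : ℝ => c ^ (m + 2) * Real.exp (-(c * s))).aestronglyMeasurable).mul ?_
    exact (aemeasurable_restrict_of_antitoneOn measurableSet_Ioi (theta_slip_antitoneOn ha ξ)).aestronglyMeasurable
  have hg : IntegrableOn (fun c : ℝ => Real.exp (-(c * s)) * c ^ (m + 2) +
      8 / a ^ 2 * (Real.exp (-(c * s)) * c ^ (m + 1)) + 16 / a ^ 4 * (Real.exp (-(c * s)) * c ^ m)) (Ioi 0) :=
    (((integrableOn_exp_neg_mul_mul_pow (m + 2) hs).add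
      ((integrableOn_exp_neg_mul_mul_pow (m + 1) hs).const_mul _)).add
      ((integrableOn_exp_neg_mul_mul_pow m hs).const_mul _))
  refine Integrable.mono' hg hmeas ?_
  refine (ae_restrict_iff' measurableSet_Ioi).2 (Eventually.of_forall fun c (hc : 0 < c) => ?_)
  have hθ0 : 0 ≤ ∑' ij : ℤ × ℤ,
      Real.exp (-c * ‖(ij.1 : ℝ) • triangularVec₁ a + (ij.2 : ℝ) • triangularVec₂ a + ξ‖ ^ 2) :=
    tsum_nonneg fun _ => (Real.exp_pos _).le
  have hθ1 := theta_slip_le ha hc ξ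
  rw [Real.norm_of_nonneg (by positivity)]
  calc c ^ (m + 2) * Real.exp (-(c * s)) *
        ∑' ij : ℤ × ℤ, Real.exp (-c * ‖(ij.1 : ℝ) • triangularVec₁ a + (ij.2 : ℝ) • triangularVec₂ a + ξ‖ ^ 2)
      ≤ c ^ (m + 2) * Real.exp (-(c * s)) * (1 + 4 / (a ^ 2 * c)) ^ 2 := by gcongr
    _ = _ := by
        field_simp
        ring

/-- **The Bernstein representation of the general-offset Lennard-Jones layer sum**: for `a > 0`, `t ≠ 0`
and in-plane `ξ`, the layer sum `Σ' V_LJ ‖i u + j v + ξ + t e₃‖` is summable, the integrand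
`Θ(a,c,ξ) w(c) e^{−ct²}` is integrable on `(0, ∞)`, and
`Σ' V_LJ ‖i u + j v + ξ + t e₃‖ = ∫_0^∞ Θ(a,c,ξ) w(c) e^{−ct²} dc`, `w = lennardJonesDensity`
(the pattern of `LayeredHull.reg_layerInteraction_eq_integral`). [folklore] -/
theorem bernstein_slip {a t : ℝ} (ha : 0 < a) (ht : t ≠ 0) (ξ : EuclideanSpace ℝ (Fin 3)) (hξ : ξ 2 = 0) :
    Summable (fun ij : ℤ × ℤ =>
        lennardJones ‖(ij.1 : ℝ) • triangularVec₁ a + (ij.2 : ℝ) • triangularVec₂ a + ξ + layerNormal t‖) ∧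
      IntegrableOn (fun c : ℝ => (∑' ij : ℤ × ℤ,
          Real.exp (-c * ‖(ij.1 : ℝ) • triangularVec₁ a + (ij.2 : ℝ) • triangularVec₂ a + ξ‖ ^ 2)) *
        lennardJonesDensity c * Real.exp (-(c * t ^ 2))) (Ioi 0) ∧
      ∑' ij : ℤ × ℤ,
          lennardJones ‖(ij.1 : ℝ) • triangularVec₁ a + (ij.2 : ℝ) • triangularVec₂ a + ξ + layerNormal t‖ =
        ∫ c in Ioi (0 : ℝ), (∑' ij : ℤ × ℤ,
            Real.exp (-c * ‖(ij.1 : ℝ) • triangularVec₁ a + (ij.2 : ℝ) • triangularVec₂ a + ξ‖ ^ 2)) *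
          lennardJonesDensity c * Real.exp (-(c * t ^ 2)) := by
  have hT : 0 < t ^ 2 := by positivity
  have h6 := (hasSum_inv_pow_integral_slip ha ξ hT 5 (by norm_num)).tsum_eq
  have h3 := (hasSum_inv_pow_integral_slip ha ξ hT 2 (by norm_num)).tsum_eq
  have hs6 := summable_inv_pow_slip ha ξ hT 6 (by norm_num)
  have hs3 := summable_inv_pow_slip ha ξ hT 3 (by norm_num)
  have hi5 := integrableOn_theta_slip_mul ha.ne' ξ hT 5 (by norm_num)
  have hi2 := integrableOn_theta_slip_mul ha.ne' ξ hT 2 (by norm_num)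
  simp only [Nat.factorial, Nat.succ_eq_add_one, Nat.cast_ofNat, Nat.reduceAdd, Nat.reduceMul] at h6 h3
  have hx2 : ∀ ij : ℤ × ℤ, ((ij.1 : ℝ) • triangularVec₁ a + (ij.2 : ℝ) • triangularVec₂ a + ξ) 2 = 0 :=
    fun ij => by rw [(slipVec_apply a ij.1 ij.2 ξ).2.2, hξ]
  have hV : ∀ ij : ℤ × ℤ,
      lennardJones ‖(ij.1 : ℝ) • triangularVec₁ a + (ij.2 : ℝ) • triangularVec₂ a + ξ + layerNormal t‖ =
      (1 / 1440) * ((120 : ℝ) /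
          (‖(ij.1 : ℝ) • triangularVec₁ a + (ij.2 : ℝ) • triangularVec₂ a + ξ‖ ^ 2 + t ^ 2) ^ (5 + 1)) -
        (1 / 12) * ((2 : ℝ) /
          (‖(ij.1 : ℝ) • triangularVec₁ a + (ij.2 : ℝ) • triangularVec₂ a + ξ‖ ^ 2 + t ^ 2) ^ (2 + 1)) :=
    fun ij => by
    rw [lennardJones_slip _ (hx2 ij) t]
    ring
  have hs6' : Summable fun ij : ℤ × ℤ => (1 / 1440) * ((120 : ℝ) /
      (‖(ij.1 : ℝ) • triangularVec₁ a + (ij.2 : ℝ) • triangularVec₂ a + ξ‖ ^ 2 + t ^ 2) ^ (5 + 1)) :=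
    ((hs6.mul_left 120).mul_left (1 / 1440)).congr fun ij => by ring
  have hs3' : Summable fun ij : ℤ × ℤ => (1 / 12) * ((2 : ℝ) /
      (‖(ij.1 : ℝ) • triangularVec₁ a + (ij.2 : ℝ) • triangularVec₂ a + ξ‖ ^ 2 + t ^ 2) ^ (2 + 1)) :=
    ((hs3.mul_left 2).mul_left (1 / 12)).congr fun ij => by ring
  have hint : IntegrableOn (fun c : ℝ => (∑' ij : ℤ × ℤ,
        Real.exp (-c * ‖(ij.1 : ℝ) • triangularVec₁ a + (ij.2 : ℝ) • triangularVec₂ a + ξ‖ ^ 2)) *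
      lennardJonesDensity c * Real.exp (-(c * t ^ 2))) (Ioi 0) := by
    refine IntegrableOn.congr_fun ((hi5.const_mul (1 / 1440)).sub (hi2.const_mul (1 / 12))) (fun c _ => ?_)
      measurableSet_Ioi
    simp only [lennardJonesDensity, Pi.sub_apply]
    ring
  refine ⟨(hs6'.sub hs3').congr fun ij => (hV ij).symm, hint, ?_⟩
  rw [tsum_congr hV, Summable.tsum_sub hs6' hs3', tsum_mul_left, tsum_mul_left, h6, h3,
    ← integral_const_mul, ← integral_const_mul, ← integral_sub (hi5.const_mul _) (hi2.const_mul _)]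
  refine setIntegral_congr_fun measurableSet_Ioi fun c _ => ?_
  simp only [lennardJonesDensity]
  ring

end SlipLayerBernstein

/-- **Stub RS (`stub_slipLayerBernstein`).**  For `a > 0` and `t ≠ 0`, the general-offset Lennard-Jones
layer sum `Ψ(a,t,ξ) = Σ'_{(i,j)} V_LJ ‖i u + j v + ξ + t e₃‖` is (i) invariant under lattice translations
`ξ ↦ ξ + p u + q v` of the offset, (ii) invariant under the in-plane rotation by `120°` of the in-plane
part `ε` of an offset `σ w + ε`, and (iii) for in-plane `ξ` it is summable, the shifted Gaussian layer
sums `Θ(a,c,ξ) = Σ' e^{−c‖i u + j v + ξ‖²}` are summable for `c > 0`, `c ↦ Θ(a,c,ξ) w(c) e^{−ct²}` is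
integrable on `(0, ∞)` and `Ψ(a,t,ξ) = ∫_0^∞ Θ(a,c,ξ) w(c) e^{−ct²} dc` with
`w(c) = lennardJonesDensity c = c⁵/1440 − c²/12`. [folklore] -/
theorem stub_slipLayerBernstein : ∀ (a t : ℝ), 0 < a → t ≠ 0 → (∀ (σ p q : ℤ) (ε : EuclideanSpace ℝ (Fin 3)), (∑' ij : ℤ × ℤ, Literature.MathematicalPhysics.StatisticalMechanics.lennardJones ‖(ij.1 : ℝ) • Literature.MathematicalPhysics.StatisticalMechanics.triangularVec₁ a + (ij.2 : ℝ) • Literature.MathematicalPhysics.StatisticalMechanics.triangularVec₂ a + (((σ : ℝ) • Literature.MathematicalPhysics.StatisticalMechanics.barlowOffset a + (p : ℝ) • Literature.MathematicalPhysics.StatisticalMechanics.triangularVec₁ a + (q : ℝ) • Literature.MathematicalPhysics.StatisticalMechanics.triangularVec₂ a) + ε) + Literature.MathematicalPhysics.StatisticalMechanics.layerNormal (t)‖) = (∑' ij : ℤ × ℤ, Literature.MathematicalPhysics.StatisticalMechanics.lennardJones ‖(ij.1 : ℝ) • Literature.MathematicalPhysics.StatisticalMechanics.triangularVec₁ a +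 (ij.2 : ℝ) • Literature.MathematicalPhysics.StatisticalMechanics.triangularVec₂ a + ((σ : ℝ) • Literature.MathematicalPhysics.StatisticalMechanics.barlowOffset a + ε) + Literature.MathematicalPhysics.StatisticalMechanics.layerNormal (t)‖)) ∧ (∀ (σ : ℤ) (ε : EuclideanSpace ℝ (Fin 3)), ε 2 = 0 → (∑' ij : ℤ × ℤ, Literature.MathematicalPhysics.StatisticalMechanics.lennardJones ‖(ij.1 : ℝ) • Literature.MathematicalPhysics.StatisticalMechanics.triangularVec₁ a + (ij.2 : ℝ) • Literature.MathematicalPhysics.StatisticalMechanics.triangularVec₂ a + ((σ : ℝ) • Literature.MathematicalPhysics.StatisticalMechanics.barlowOffset a + (!₂[-((ε) 0) / 2 - Real.sqrt 3 / 2 * (ε) 1, Real.sqrt 3 / 2 * (ε) 0 - (ε) 1 / 2, 0] : EuclideanSpace ℝ (Fin 3))) + Literature.MathematicalPhysics.StatisticalMechanics.layerNormal (t)‖) = (∑' ij : ℤ × ℤ, Literature.MathematicalPhysics.StatisticalMechanics.lennardJones ‖(ij.1 : ℝ) • Literature.MathematicalPhysics.StatisticalMechanics.triangularVec₁ a + (ij.2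 : ℝ) • Literature.MathematicalPhysics.StatisticalMechanics.triangularVec₂ a + ((σ : ℝ) • Literature.MathematicalPhysics.StatisticalMechanics.barlowOffset a + ε) + Literature.MathematicalPhysics.StatisticalMechanics.layerNormal (t)‖)) ∧ (∀ ξ : EuclideanSpace ℝ (Fin 3), ξ 2 = 0 → Summable (fun ij : ℤ × ℤ => Literature.MathematicalPhysics.StatisticalMechanics.lennardJones ‖(ij.1 : ℝ) • Literature.MathematicalPhysics.StatisticalMechanics.triangularVec₁ a + (ij.2 : ℝ) • Literature.MathematicalPhysics.StatisticalMechanics.triangularVec₂ a + ξ + Literature.MathematicalPhysics.StatisticalMechanics.layerNormal (t)‖) ∧ (∀ c : ℝ, 0 < c → Summable (fun ij : ℤ × ℤ => Real.exp (-c * ‖(ij.1 : ℝ) • Literature.MathematicalPhysics.StatisticalMechanics.triangularVec₁ a + (ij.2 : ℝ) • Literature.MathematicalPhysics.StatisticalMechanics.triangularVec₂ a + ξ‖ ^ 2))) ∧ MeasureTheory.IntegrableOn (fun c : ℝ => (∑' ij : ℤ × ℤ, Real.exp (-(c) * ‖(ij.1 : ℝ) • Literature.MathematicalPhysics.StatisticalMechanics.triangularVec₁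 a + (ij.2 : ℝ) • Literature.MathematicalPhysics.StatisticalMechanics.triangularVec₂ a + (ξ)‖ ^ 2)) * Literature.MathematicalPhysics.StatisticalMechanics.lennardJonesDensity c * Real.exp (-(c * t ^ 2))) (Set.Ioi 0) ∧ (∑' ij : ℤ × ℤ, Literature.MathematicalPhysics.StatisticalMechanics.lennardJones ‖(ij.1 : ℝ) • Literature.MathematicalPhysics.StatisticalMechanics.triangularVec₁ a + (ij.2 : ℝ) • Literature.MathematicalPhysics.StatisticalMechanics.triangularVec₂ a + (ξ) + Literature.MathematicalPhysics.StatisticalMechanics.layerNormal (t)‖) = ∫ c in Set.Ioi (0 : ℝ), (∑' ij : ℤ × ℤ, Real.exp (-(c) * ‖(ij.1 : ℝ) • Literature.MathematicalPhysics.StatisticalMechanics.triangularVec₁ a + (ij.2 : ℝ) • Literature.MathematicalPhysics.StatisticalMechanics.triangularVec₂ a + (ξ)‖ ^ 2)) * Literature.MathematicalPhysics.StatisticalMechanics.lennardJonesDensity c * Real.exp (-(c * t ^ 2))) := by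
  intro a t ha ht
  refine ⟨fun σ p q ε => SlipLayerBernstein.tsum_translate lennardJones a t σ p q ε,
    fun σ ε hε => SlipLayerBernstein.tsum_rotate lennardJones a t σ ε hε, fun ξ hξ => ?_⟩
  obtain ⟨h1, h2, h3⟩ := SlipLayerBernstein.bernstein_slip ha ht ξ hξ
  exact ⟨h1, fun c hc => SlipLayerBernstein.summable_gauss_slip ha.ne' hc ξ, h2, h3⟩

end Summit.AtomisticToContinuum.Crystallization.Theorems.HcpLandscapeGapBirth

end
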